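import Summits.QuantumFields.YangMills.Theorems.LuscherReductionTwistedTraceScalingRiccatiZPE
import HarnessLib

/-!
# Frame algebra for the k = 0 FLOOR: the gain rate of a soft mode, the soft sub-solution defect of a curvature `F = D w + r`,
# and the normal-mode product of the Riccati trial state BOUNDED BELOW (lane A of S-BASE, crux `TwistedTraceScaling`
# stmt-QuantumFields-20203; design note `pub/ym-fleet/ym-luscher-20007-p1/COARSE-DESIGN.md` §18)

The k = 0 floor `λ₀(β,L) ≥ N·e^{−6Z₀}·e^{−o(δ)}` (`ValleyFloorAt`, `…ValleyBOUpper`) is a SUB-solution bound for the covariant Riccati trial state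
`H = stiffTrial (riccatiWeight t b μ)` near the vacuum tube.  Lane B's closed form (`Harm.integral_harmonicStep_weightForm`) writes the Gaussian model
step at `U` as `e^{−t‖F‖²} Πᵢ √(π/sᵢ) e^{2tφᵢ²/λᵢ} e^{−κᵢ(φᵢ/λᵢ)²} e^{−ĉᵢφᵢ²}`, `sᵢ = tλᵢ + b + ĉᵢλᵢ²`, `κᵢ = stepGain λᵢ t b ĉᵢ`, `φᵢ = ⟨D eᵢ, F⟩`.
The UPPER direction (`…PointwiseSuper`) discards `e^{−κᵢ(φᵢ/λᵢ)²} ≤ 1` and the Bianchi defect; the LOWER direction must BOUND them.  This file is the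
frame algebra (any real inner-product spaces, any eigenframe `D†D eᵢ = λᵢ eᵢ`):
* §1 `stepGain_le_mul` — for a non-negative weight the gain rate is at most `λ·(2t + t²λ/b)` (so `≈ βλ` on a soft mode: SECOND order in the softness);
* §2 ★ `sum_softDefect_le` — if `0 ≤ κᵢ ≤ a·λᵢ` and `κᵢ ≤ a·Λ` for every mode (stiff modes: `κᵢ = 0`; soft modes: `λᵢ ≤ Λ`), then for EVERY decomposition
  `F = D w + r` of the curvature: `Σᵢ κᵢ(φᵢ/λᵢ)² ≤ 2a(Λ‖w‖² + ‖r‖²)` (Parseval + Bessel `Σᵢ⟨Deᵢ,r⟩²/λᵢ ≤ ‖r‖²`) — with `Λ = O(τ²)`, `‖w‖ = O(τ)`, `‖r‖ = O(τ²)`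
  on the vacuum tube this is `O(βτ⁴)`, NOT `O(1)` (correcting design note §17.10);
* §3 `exp_potential_defect_ge` — the potential/Bianchi bookkeeping of the lower direction:
  `e^{−t(S − ‖F‖²)}·e^{−2t‖F − Dw‖²} ≤ e^{−tS}·e^{−t‖F‖²}·e^{Σᵢ 2tφᵢ²/λᵢ}` (`Harm.norm_sq_sub_sum_le`);
* §4 ★ `sqrt_pi_div_riccati_ge` / `prod_sqrt_pi_div_riccati_ge` / `prod_gram_riccati_ge_zpeSum` — the normal-mode product of the Riccati weight BOUNDED BELOW:
  `Πᵢ √(π/sᵢ) ≥ √(π/b)^n · e^{−Σᵢ modeZPE((t/b)λᵢ)} · e^{−n·((t+ĝ)/(2b))·Λ}` whenever every soft mode (`λᵢ < μ`) has `λᵢ ≤ Λ` (`ĝ = √(t²+2tb/μ)`; stiff modes are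
  EXACTLY Riccati, `sqrt_pi_div_eq`); at `U`: `≥ √(π/b)^{3|E|}·e^{−zpeSum L (t/b) U}·e^{−3|E|·((t+ĝ)/(2b))·Λ}`.
HONEST FRAMING: finite-dimensional linear algebra for a stub lane of a child of the CONDITIONAL reduction route (femto rung R2b1); not infinite volume, not a gap,
not Clay.

## References
* M. Lüscher, Nucl. Phys. B219 (1983) 233, §3. [Luscher1983]
* A. Wipf, LNP 992 (2021), §8.5.1–§8.5.2. [Wipf2021]
* R. A. Horn, C. R. Johnson, *Matrix Analysis* (2nd ed., 2013), Thm 7.3.2. [HornJohnson2013]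
-/

set_option autoImplicit false

noncomputable section

open Real Finset
open scoped BigOperators RealInnerProductSpace
open Literature.MathematicalPhysics.QuantumFieldTheory
open Literature.MathematicalPhysics.QuantumLattice

namespace Summit.QuantumFields.YangMills.Theorems.FemtoTransferGap.TwoLattice.Harm

open Summit.QuantumFields.YangMills.Theorems.FemtoTransferGap
open Summit.QuantumFields.YangMills.Theorems.FemtoTransferGap.TwoLattice
open Summit.QuantumFields.YangMills.Theorems.FemtoTransferGap.TwoLattice.Stiff
open Summit.QuantumFields.YangMills.Theorems.FemtoTransferGap.TwoLattice.Cov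
open Summit.QuantumFields.YangMills.Theorems.FemtoTransferGap.TwoLattice.Toron

/-! ## §1 The gain rate of a non-negative weight -/

/-- For a non-negative weight `ĉ` on a mode `λ ≥ 0` (`t ≥ 0`, `b > 0`): `stepGain λ t b ĉ ≤ λ·(2t + t²λ/b)` — numerator `≤ (tλ)² + 2tλb`, denominator `≥ b`.
[cite: Wipf2021, §8.5.1 (8.56)–(8.57)] -/
theorem stepGain_le_mul {lam t b ĉ : ℝ} (hlam : 0 ≤ lam) (ht : 0 ≤ t) (hb : 0 < b) (hĉ : 0 ≤ ĉ) :
    stepGain lam t b ĉ ≤ lam * (2 * t + t ^ 2 * lam / b) := by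
  rw [stepGain_eq]
  have ha : 0 ≤ t * lam := mul_nonneg ht hlam
  have hc : 0 ≤ ĉ * lam ^ 2 := mul_nonneg hĉ (sq_nonneg _)
  have hden : b ≤ t * lam + b + ĉ * lam ^ 2 := by linarith
  have hdenpos : 0 < t * lam + b + ĉ * lam ^ 2 := lt_of_lt_of_le hb hden
  rw [div_le_iff₀ hdenpos]
  have hfac : 0 ≤ lam * (2 * t + t ^ 2 * lam / b) := by positivity
  have h1 : lam * (2 * t + t ^ 2 * lam / b) * b ≤ lam * (2 * t + t ^ 2 * lam / b) * (t * lam + b + ĉ * lam ^ 2) :=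
    mul_le_mul_of_nonneg_left hden hfac
  have h2 : lam * (2 * t + t ^ 2 * lam / b) * b = (t * lam) ^ 2 + 2 * (t * lam) * b := by
    field_simp
    ring
  nlinarith [sq_nonneg (ĉ * lam ^ 2)]

/-! ## §2 The soft sub-solution defect of a curvature `F = D w + r` -/

section Frame

variable {V W : Type*} [NormedAddCommGroup V] [InnerProductSpace ℝ V] [FiniteDimensional ℝ V]
  [NormedAddCommGroup W] [InnerProductSpace ℝ W] [FiniteDimensional ℝ W]
variable {ι : Type*} [Fintype ι]
variable {D : V →ₗ[ℝ] W} {e : OrthonormalBasis ι ℝ V} {lam : ι → ℝ}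

/-- One mode: if `0 ≤ κᵢ ≤ a·λᵢ` and `κᵢ ≤ a·Λ`, then for `F = D w + r`,
`κᵢ·(⟨Deᵢ,F⟩/λᵢ)² ≤ 2aΛ·⟨eᵢ,w⟩² + 2a·⟨Deᵢ,r⟩²/λᵢ` (`⟨Deᵢ, Dw⟩ = λᵢ⟨eᵢ,w⟩`; a zero mode contributes `0`). [cite: HornJohnson2013, Thm 7.3.2] -/
theorem mode_softDefect_le (hD : ∀ i, D.adjoint (D (e i)) = lam i • e i) {κ : ι → ℝ} {a Λ : ℝ}
    (hκ0 : ∀ i, 0 ≤ κ i) (hκ1 : ∀ i, κ i ≤ a * lam i) (hκ2 : ∀ i, κ i ≤ a * Λ) (w : V) (r : W) (i : ι) :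
    κ i * (⟪D (e i), D w + r⟫ / lam i) ^ 2 ≤ 2 * (a * Λ) * ⟪e i, w⟫ ^ 2 + 2 * a * (⟪D (e i), r⟫ ^ 2 / lam i) := by
  have ha0 : 0 ≤ a * Λ := (hκ0 i).trans (hκ2 i)
  by_cases hl : lam i = 0
  · -- zero mode: `D eᵢ = 0`
    have hDe : D (e i) = 0 := (eigenvalue_eq_zero_iff hD i).mp hl
    rw [hDe, inner_zero_left, inner_zero_left, hl]
    simp only [zero_div, ne_eq, OfNat.ofNat_ne_zero, not_false_eq_true, zero_pow, mul_zero, add_zero]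
    positivity
  · have hlpos : 0 < lam i := lt_of_le_of_ne (eigenvalue_nonneg hD i) (Ne.symm hl)
    have hφ : ⟪D (e i), D w + r⟫ / lam i = ⟪e i, w⟫ + ⟪D (e i), r⟫ / lam i := by
      rw [inner_add_right, inner_map_map_right hD]
      field_simp
    rw [hφ]
    have hsq : (⟪e i, w⟫ + ⟪D (e i), r⟫ / lam i) ^ 2 ≤ 2 * ⟪e i, w⟫ ^ 2 + 2 * (⟪D (e i), r⟫ / lam i) ^ 2 := by
      nlinarith [sq_nonneg (⟪e i, w⟫ - ⟪D (e i), r⟫ / lam i)]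
    have hdiv : (⟪D (e i), r⟫ / lam i) ^ 2 = (⟪D (e i), r⟫ ^ 2 / lam i) / lam i := by
      field_simp
    calc κ i * (⟪e i, w⟫ + ⟪D (e i), r⟫ / lam i) ^ 2
        ≤ κ i * (2 * ⟪e i, w⟫ ^ 2 + 2 * (⟪D (e i), r⟫ / lam i) ^ 2) := mul_le_mul_of_nonneg_left hsq (hκ0 i)
      _ = 2 * κ i * ⟪e i, w⟫ ^ 2 + 2 * (κ i / lam i) * (⟪D (e i), r⟫ ^ 2 / lam i) := by rw [hdiv]; field_simp
      _ ≤ 2 * (a * Λ) * ⟪e i, w⟫ ^ 2 + 2 * a * (⟪D (e i), r⟫ ^ 2 / lam i) := by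
          have h1 : κ i / lam i ≤ a := (div_le_iff₀ hlpos).mpr (hκ1 i)
          have h2 : 0 ≤ ⟪D (e i), r⟫ ^ 2 / lam i := div_nonneg (sq_nonneg _) hlpos.le
          gcongr
          exact hκ2 i

/-- ★ **THE SOFT SUB-SOLUTION DEFECT IS SECOND ORDER.**  In an eigenframe `D†D eᵢ = λᵢ eᵢ`, let gain rates `κᵢ` satisfy `0 ≤ κᵢ ≤ a·λᵢ` and `κᵢ ≤ a·Λ`
for every mode (stiff modes of the Riccati weight: `κᵢ = 0`; soft modes: `κᵢ ≤ λᵢ(2t+t²λᵢ/b)` and `λᵢ ≤ Λ`).  Then for every decomposition `F = D w + r`: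
`Σᵢ κᵢ·(⟨Deᵢ,F⟩/λᵢ)² ≤ 2a·(Λ‖w‖² + ‖r‖²)`. [cite: HornJohnson2013, Thm 7.3.2] [cite: Luscher1983, §3] -/
theorem sum_softDefect_le (hD : ∀ i, D.adjoint (D (e i)) = lam i • e i) {κ : ι → ℝ} {a Λ : ℝ} (ha : 0 ≤ a)
    (hκ0 : ∀ i, 0 ≤ κ i) (hκ1 : ∀ i, κ i ≤ a * lam i) (hκ2 : ∀ i, κ i ≤ a * Λ) (w : V) (r : W) :
    ∑ i, κ i * (⟪D (e i), D w + r⟫ / lam i) ^ 2 ≤ 2 * a * (Λ * ‖w‖ ^ 2 + ‖r‖ ^ 2) := by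
  calc ∑ i, κ i * (⟪D (e i), D w + r⟫ / lam i) ^ 2
      ≤ ∑ i, (2 * (a * Λ) * ⟪e i, w⟫ ^ 2 + 2 * a * (⟪D (e i), r⟫ ^ 2 / lam i)) :=
        Finset.sum_le_sum fun i _ => mode_softDefect_le hD hκ0 hκ1 hκ2 w r i
    _ = 2 * (a * Λ) * ∑ i, ⟪e i, w⟫ ^ 2 + 2 * a * ∑ i, ⟪D (e i), r⟫ ^ 2 / lam i := by
        rw [Finset.sum_add_distrib, ← Finset.mul_sum, ← Finset.mul_sum]
    _ ≤ 2 * (a * Λ) * ‖w‖ ^ 2 + 2 * a * ‖r‖ ^ 2 := by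
        rw [← norm_sq_eq_sum_coord e w]
        have hB := sum_sq_div_le_norm_sq hD r
        nlinarith
    _ = 2 * a * (Λ * ‖w‖ ^ 2 + ‖r‖ ^ 2) := by ring

/-! ## §3 The potential / Bianchi bookkeeping of the lower direction -/

/-- `e^{−t(S − ‖F‖²)}·e^{−2t‖F − Dw‖²} ≤ e^{−tS}·(e^{−t‖F‖²}·e^{Σᵢ 2tφᵢ²/λᵢ})` for every trial preimage `w` (`t ≥ 0`): the defect
`‖F‖² − Σᵢφᵢ²/λᵢ = dist(F, range D)²` is at most `‖F − Dw‖²`. [cite: HornJohnson2013, Thm 7.3.2] -/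
theorem exp_potential_defect_ge (hD : ∀ i, D.adjoint (D (e i)) = lam i • e i) {t : ℝ} (ht : 0 ≤ t) (F : W) (w : V) (S : ℝ) :
    Real.exp (-(t * (S - ‖F‖ ^ 2))) * Real.exp (-(2 * t * ‖F - D w‖ ^ 2)) ≤
      Real.exp (-t * S) * (Real.exp (-(t * ‖F‖ ^ 2)) * Real.exp (∑ i, 2 * t * ⟪D (e i), F⟫ ^ 2 / lam i)) := by
  rw [← Real.exp_add, ← Real.exp_add, ← Real.exp_add, Real.exp_le_exp]
  have h := norm_sq_sub_sum_le hD F w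
  have e1 : ∑ i, 2 * t * ⟪D (e i), F⟫ ^ 2 / lam i = 2 * t * ∑ i, ⟪D (e i), F⟫ ^ 2 / lam i := by
    rw [Finset.mul_sum]; exact Finset.sum_congr rfl fun i _ => by ring
  rw [e1]
  nlinarith

end Frame

/-! ## §4 The normal-mode product of the Riccati trial state, bounded below -/

/-- `√(π/(b·e^{x})) = √(π/b)·e^{−x/2}` (`b > 0`). [folklore] -/
private theorem sqrt_pi_div_mul_exp {b : ℝ} (hb : 0 < b) (x : ℝ) :
    Real.sqrt (Real.pi / (b * Real.exp x)) = Real.sqrt (Real.pi / b) * Real.exp (-(x / 2)) := by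
  have hx : Real.exp (-x) = Real.exp (-(x / 2)) ^ 2 := by
    rw [← Real.exp_nat_mul]; congr 1; push_cast; ring
  rw [div_mul_eq_div_div, div_eq_mul_inv (Real.pi / b), ← Real.exp_neg, hx, Real.sqrt_mul (div_nonneg Real.pi_pos.le hb.le),
    Real.sqrt_sq (Real.exp_pos _).le]

/-- ★ **Per mode, LOWER**: for `g = riccatiWeight t b μ` (`t ≥ 0`, `b, μ > 0`), `λ ≥ 0`, and a softness bound `λ < μ → λ ≤ Λ` (`Λ ≥ 0`):
`√(π/b)·e^{−modeZPE((t/b)λ)}·e^{−((t+ĝ)/(2b))·Λ} ≤ √(π/(tλ + b + g(λ)λ²))`, `ĝ = √(t²+2tb/μ)` — a stiff mode is EXACTLY Riccati (`sqrt_pi_div_eq`); on a soft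
mode `tλ + g(λ)λ² ≤ (t + ĝ)λ ≤ (t+ĝ)Λ` (`riccatiWeight_mul_le`) and `b + y ≤ b·e^{y/b}`. [cite: Wipf2021, §8.5.1 (8.56)–(8.58)] -/
theorem sqrt_pi_div_riccati_ge {t b μ lam Λ : ℝ} (ht : 0 ≤ t) (hb : 0 < b) (hμ : 0 < μ) (hlam : 0 ≤ lam) (hΛ : 0 ≤ Λ)
    (hsoft : lam < μ → lam ≤ Λ) :
    Real.sqrt (Real.pi / b) * Real.exp (-modeZPE (t / b * lam)) *
        Real.exp (-((t + Real.sqrt (t ^ 2 + 2 * t * b / μ)) / (2 * b) * Λ)) ≤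
      Real.sqrt (Real.pi / (t * lam + b + riccatiWeight t b μ lam * lam ^ 2)) := by
  set ĝ : ℝ := Real.sqrt (t ^ 2 + 2 * t * b / μ) with hĝ
  have hĝ0 : 0 ≤ ĝ := Real.sqrt_nonneg _
  have hab : t / b * lam = t * lam / b := by ring
  have hE1 : Real.exp (-((t + ĝ) / (2 * b) * Λ)) ≤ 1 := by
    rw [Real.exp_le_one_iff, neg_nonpos]; positivity
  by_cases hμl : μ ≤ lam
  · -- stiff: exactly Riccati
    have hc0 : 0 ≤ riccatiWeight t b μ lam * lam ^ 2 := mul_nonneg (riccatiWeight_nonneg hμ lam) (sq_nonneg _)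
    have hcsq := riccatiWeight_riccati (t := t) (b := b) hμ ht hb.le hμl
    rw [sqrt_pi_div_eq (a := t * lam) (by positivity) hb hc0 hcsq, hab]
    exact mul_le_of_le_one_right (by positivity) hE1
  · -- soft: `λ ≤ Λ`
    push Not at hμl
    have hlΛ : lam ≤ Λ := hsoft hμl
    have hg : riccatiWeight t b μ lam * lam ^ 2 ≤ ĝ * lam := by
      have h1 := riccatiWeight_mul_le (t := t) (b := b) hμ ht hb.le hlam
      calc riccatiWeight t b μ lam * lam ^ 2 = (riccatiWeight t b μ lam * lam) * lam := by ring
        _ ≤ ĝ * lam := mul_le_mul_of_nonneg_right h1 hlam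
    have hden : t * lam + b + riccatiWeight t b μ lam * lam ^ 2 ≤ b * Real.exp ((t + ĝ) / b * Λ) := by
      have h2 : t * lam + b + riccatiWeight t b μ lam * lam ^ 2 ≤ b + (t + ĝ) * Λ := by nlinarith
      have h3 : b + (t + ĝ) * Λ ≤ b * Real.exp ((t + ĝ) / b * Λ) := by
        have h4 : 1 + (t + ĝ) / b * Λ ≤ Real.exp ((t + ĝ) / b * Λ) := by linarith [Real.add_one_le_exp ((t + ĝ) / b * Λ)]
        have h5 : b + (t + ĝ) * Λ = b * (1 + (t + ĝ) / b * Λ) := by field_simp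
        rw [h5]
        exact mul_le_mul_of_nonneg_left h4 hb.le
      exact h2.trans h3
    have hdenpos : 0 < t * lam + b + riccatiWeight t b μ lam * lam ^ 2 := by
      have : 0 ≤ riccatiWeight t b μ lam * lam ^ 2 := mul_nonneg (riccatiWeight_nonneg hμ lam) (sq_nonneg _)
      positivity
    have h1 : Real.sqrt (Real.pi / (b * Real.exp ((t + ĝ) / b * Λ))) ≤
        Real.sqrt (Real.pi / (t * lam + b + riccatiWeight t b μ lam * lam ^ 2)) :=
      Real.sqrt_le_sqrt (div_le_div_of_nonneg_left Real.pi_pos.le hdenpos hden)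
    refine le_trans ?_ h1
    rw [sqrt_pi_div_mul_exp hb]
    have hE2 : Real.exp (-modeZPE (t / b * lam)) ≤ 1 := by
      rw [Real.exp_le_one_iff, neg_nonpos]; exact modeZPE_nonneg (by positivity)
    have heq : -((t + ĝ) / b * Λ / 2) = -((t + ĝ) / (2 * b) * Λ) := by ring
    rw [heq]
    calc Real.sqrt (Real.pi / b) * Real.exp (-modeZPE (t / b * lam)) * Real.exp (-((t + ĝ) / (2 * b) * Λ))
        ≤ Real.sqrt (Real.pi / b) * 1 * Real.exp (-((t + ĝ) / (2 * b) * Λ)) := by gcongr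
      _ = _ := by rw [mul_one]

/-- ★★ **Product form, LOWER**: `√(π/b)^{|ι|}·e^{−Σᵢ modeZPE((t/b)λᵢ)}·e^{−|ι|·((t+ĝ)/(2b))·Λ} ≤ Πᵢ √(π/(tλᵢ + b + g(λᵢ)λᵢ²))` whenever every soft mode
(`λᵢ < μ`) has `λᵢ ≤ Λ`. [cite: Wipf2021, §8.5.1 (8.56)–(8.58)] -/
theorem prod_sqrt_pi_div_riccati_ge {ι : Type*} [Fintype ι] {lam : ι → ℝ} {t b μ Λ : ℝ} (hlam : ∀ i, 0 ≤ lam i) (ht : 0 ≤ t) (hb : 0 < b)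
    (hμ : 0 < μ) (hΛ : 0 ≤ Λ) (hsoft : ∀ i, lam i < μ → lam i ≤ Λ) :
    Real.sqrt (Real.pi / b) ^ Fintype.card ι * Real.exp (-∑ i, modeZPE (t / b * lam i)) *
        Real.exp (-(Fintype.card ι * ((t + Real.sqrt (t ^ 2 + 2 * t * b / μ)) / (2 * b) * Λ))) ≤
      ∏ i, Real.sqrt (Real.pi / (t * lam i + b + riccatiWeight t b μ (lam i) * lam i ^ 2)) := by
  have heq : ∏ i, Real.sqrt (Real.pi / b) * Real.exp (-modeZPE (t / b * lam i)) *
        Real.exp (-((t + Real.sqrt (t ^ 2 + 2 * t * b / μ)) / (2 * b) * Λ)) =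
      Real.sqrt (Real.pi / b) ^ Fintype.card ι * Real.exp (-∑ i, modeZPE (t / b * lam i)) *
        Real.exp (-(Fintype.card ι * ((t + Real.sqrt (t ^ 2 + 2 * t * b / μ)) / (2 * b) * Λ))) := by
    rw [prod_mul_distrib, prod_mul_distrib, prod_const, prod_const, card_univ, ← Real.exp_sum, ← Real.exp_nat_mul, sum_neg_distrib,
      mul_neg]
  rw [← heq]
  exact prod_le_prod (fun i _ => by positivity) fun i _ => sqrt_pi_div_riccati_ge ht hb hμ (hlam i) hΛ (hsoft i)

variable {L : ℕ} [NeZero L]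

/-- ★★ **At `U`, LOWER**: if every soft Gram eigenvalue of `D_U` (`λᵢ < μ`) is `≤ Λ`, then lane B's normal-mode product is at least
`√(π/b)^{3|E|}·e^{−zpeSum L (t/b) U}·e^{−3|E|·((t+ĝ)/(2b))·Λ}`. [cite: Wipf2021, §8.5.1 (8.56)–(8.58)] [cite: Luscher1983, §3] -/
theorem prod_gram_riccati_ge_zpeSum (U : GaugeConfig 3 L SU2) {t b μ Λ : ℝ} (ht : 0 ≤ t) (hb : 0 < b) (hμ : 0 < μ) (hΛ : 0 ≤ Λ)
    (hsoft : ∀ i, (gramMatrix_isHermitian (covCurl U)).eigenvalues i < μ → (gramMatrix_isHermitian (covCurl U)).eigenvalues i ≤ Λ) :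
    Real.sqrt (Real.pi / b) ^ (Fintype.card (Edge 3 L) * 3) * Real.exp (-zpeSum L (t / b) U) *
        Real.exp (-((Fintype.card (Edge 3 L) * 3 : ℕ) * ((t + Real.sqrt (t ^ 2 + 2 * t * b / μ)) / (2 * b) * Λ))) ≤
      ∏ i, Real.sqrt (Real.pi / (t * (gramMatrix_isHermitian (covCurl U)).eigenvalues i + b +
        riccatiWeight t b μ ((gramMatrix_isHermitian (covCurl U)).eigenvalues i) * (gramMatrix_isHermitian (covCurl U)).eigenvalues i ^ 2)) := by
  have h := prod_sqrt_pi_div_riccati_ge (fun i => gram_eigenvalues_nonneg (covCurl U) i) ht hb hμ hΛ hsoft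
  rw [sum_modeZPE_gram_eq_zpeSum U (t / b)] at h
  have hcard : Fintype.card (Edge 3 L × Fin 3) = Fintype.card (Edge 3 L) * 3 := by rw [Fintype.card_prod, Fintype.card_fin]
  rw [hcard] at h
  exact h

end Summit.QuantumFields.YangMills.Theorems.FemtoTransferGap.TwoLattice.Harm

end
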